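import Mathlib.Analysis.Convex.Cone.Extension
import Summits.SmoothPoincare4.SmoothPoincare4.Theses.SullivanDual

/-!
# SmoothPoincare4 / SullivanDual — `AlgebraicConeDuality` (support)

Settles item stmt-SmoothPoincare4-7828 of route SullivanDual: the purely algebraic Hahn–Banach
engine behind Sullivan's duality "transversal closed form XOR structure cycle"
(Sullivan 1976, Invent. Math. 36, Thm I.7): in a real vector space `E`, an algebraically open
convex cone `Q` (closed under positive scalars; `q + t • b ∈ Q` for `|t|` small, every `q ∈ Q`,
every direction `b`) disjoint from an affine subspace `a + V` admits a linear functional `T`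
with `T > 0` on `Q`, `T = 0` on `V` and `T a ≤ 0`.

Proof (no topology): if `Q = ∅` take `T = 0`. Otherwise pick `q₀ ∈ Q` and let `P` be the pointed
cone `{0} ∪ {q - c • a + v | q ∈ Q, c > 0, v ∈ V}`; disjointness says exactly that no
`q - c • a + v` vanishes. Put `x₀ := q₀ - a ∈ P` and `f (t • x₀) := t` on `ℝ ∙ x₀`; `f ≥ 0` on
`P ∩ ℝ ∙ x₀` (a negative multiple of `x₀` in `P` would add up with a positive one to `0 ∈ P ∖ {0}`),
and `ℝ ∙ x₀ + P = E` because `Q` is algebraically open at `q₀` and a cone. Mathlib's M. Riesz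
extension theorem `riesz_extension` gives a linear `g ≥ 0` on `P` with `g x₀ = 1`; then
`g = 0` on `V` (`x₀ + s • v ∈ P` for all `s`), `g a ≤ 0` (`c • q₀ - a ∈ P` for all `c > 0`),
and `g > 0` on `Q` (`q - δ • x₀ ∈ Q ⊆ P` for small `δ > 0`, so `g q ≥ δ`).
No named facts are used; imports: the route file and `Mathlib.Analysis.Convex.Cone.Extension`.
-/

-- the prescribed namespace `Summit.<P>.<Sub>.…` duplicates `SmoothPoincare4` (P = Sub)
set_option linter.dupNamespace false

namespace Summit.SmoothPoincare4.SmoothPoincare4.Theorems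

open Summit.SmoothPoincare4.SmoothPoincare4.Theses.SullivanDual

/-- Settles stmt-SmoothPoincare4-7828 (`AlgebraicConeDuality`, support of route SullivanDual):
for a real vector space `E`, a convex set `Q` closed under positive scalars and algebraically
open, a submodule `V` and a point `a` with `(a + V) ∩ Q = ∅`, there is a linear `T : E →ₗ[ℝ] ℝ`
with `0 < T q` for `q ∈ Q`, `T v = 0` for `v ∈ V`, and `T a ≤ 0`.
Proof: M. Riesz extension (`riesz_extension`) applied to the pointed cone
`{0} ∪ {q - c • a + v | q ∈ Q, c > 0, v ∈ V}` and the functional `t • (q₀ - a) ↦ t`;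
see the module docstring. [cite: Sullivan1976, Thm I.7] (the abstract duality step) -/
theorem AlgebraicConeDuality_proof :
    Summit.SmoothPoincare4.SmoothPoincare4.Theses.SullivanDual.AlgebraicConeDuality := by
  unfold AlgebraicConeDuality
  intro E _ _ Q V a hconv hcone hopen hdisj
  by_cases hQ : Q.Nonempty
  swap
  · refine ⟨0, fun q hq => (hQ ⟨q, hq⟩).elim, fun v _ => rfl, le_rfl⟩
  obtain ⟨q₀, hq₀⟩ := hQ
  -- `Q` is closed under addition (convex + cone)
  have hadd : ∀ q₁ ∈ Q, ∀ q₂ ∈ Q, q₁ + q₂ ∈ Q := by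
    intro q₁ hq₁ q₂ hq₂
    have hmid : (1 / 2 : ℝ) • q₁ + (1 / 2 : ℝ) • q₂ ∈ Q :=
      hconv hq₁ hq₂ (by norm_num) (by norm_num) (by norm_num)
    have h2 := hcone 2 _ two_pos hmid
    convert h2 using 1
    module
  -- membership in the nonzero part of the cone `P`
  set InP : E → Prop := fun x => ∃ q ∈ Q, ∃ c : ℝ, 0 < c ∧ ∃ v ∈ V, x = q - c • a + v
    with hInP
  have hPadd : ∀ x y : E, InP x → InP y → InP (x + y) := by
    rintro x y ⟨q₁, hq₁, c₁, hc₁, v₁, hv₁, rfl⟩ ⟨q₂, hq₂, c₂, hc₂, v₂, hv₂, rfl⟩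
    exact ⟨q₁ + q₂, hadd _ hq₁ _ hq₂, c₁ + c₂, by positivity, v₁ + v₂, V.add_mem hv₁ hv₂,
      by module⟩
  have hPsmul : ∀ (d : ℝ) (x : E), 0 < d → InP x → InP (d • x) := by
    rintro d x hd ⟨q, hq, c, hc, v, hv, rfl⟩
    exact ⟨d • q, hcone d q hd hq, d * c, by positivity, d • v, V.smul_mem d hv, by module⟩
  -- disjointness from `a + V` says: the nonzero part misses `0`
  have hP0 : ∀ x : E, InP x → x ≠ 0 := by
    rintro x ⟨q, hq, c, hc, v, hv, rfl⟩ h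
    have hq' : q = c • a - v := by
      rw [← sub_eq_zero, ← h]
      abel
    refine hdisj (-(c⁻¹ • v)) (V.neg_mem (V.smul_mem _ hv)) ?_
    have : a + -(c⁻¹ • v) = c⁻¹ • q := by
      rw [hq', smul_sub, smul_smul, inv_mul_cancel₀ hc.ne', one_smul]
      abel
    rw [this]
    exact hcone _ _ (inv_pos.mpr hc) hq
  -- every element of `Q` lies in the nonzero part (algebraic openness in direction `a`)
  have hQP : ∀ q ∈ Q, InP q := by
    intro q hq
    obtain ⟨δ, hδ, hδQ⟩ := hopen q hq a
    refine ⟨q + δ • a, hδQ δ (by rw [abs_of_pos hδ]), δ, hδ, 0, V.zero_mem, ?_⟩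
    module
  -- the pointed cone
  let P : PointedCone ℝ E :=
    { carrier := {x | x = 0 ∨ InP x}
      zero_mem' := Or.inl rfl
      add_mem' := by
        rintro x y (rfl | hx) (rfl | hy)
        · exact Or.inl (by simp)
        · exact Or.inr (by simpa using hy)
        · exact Or.inr (by simpa using hx)
        · exact Or.inr (hPadd x y hx hy)
      smul_mem' := by
        rintro ⟨d, hd⟩ x hx
        rcases eq_or_lt_of_le hd with rfl | hd'
        · exact Or.inl (by simp [Nonneg.mk_smul])
        rcases hx with rfl | hx
        · exact Or.inl (by simp)
        · exact Or.inr (by simpa [Nonneg.mk_smul] using hPsmul d x hd' hx) }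
  have hmemP : ∀ x : E, x ∈ P ↔ x = 0 ∨ InP x := fun x => Iff.rfl
  -- the base point and the partial functional
  set x₀ : E := q₀ - a with hx₀
  have hx₀P : InP x₀ := ⟨q₀, hq₀, 1, one_pos, 0, V.zero_mem, by simp [hx₀]⟩
  have hx₀ne : x₀ ≠ 0 := hP0 x₀ hx₀P
  obtain ⟨f, hfdom, hfapply⟩ : ∃ f : E →ₗ.[ℝ] ℝ, f.domain = Submodule.span ℝ {x₀} ∧
      ∀ (t : ℝ) (x : f.domain), (x : E) = t • x₀ → f x = t := by
    refine ⟨LinearPMap.mkSpanSingleton x₀ (1 : ℝ) hx₀ne, rfl, ?_⟩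
    intro t x hx
    have hx' : x = ⟨t • x₀, hx ▸ x.2⟩ := Subtype.ext hx
    rw [hx', LinearPMap.mkSpanSingleton'_apply]
    simp
  have hfmem : ∀ x : f.domain, ∃ t : ℝ, t • x₀ = (x : E) := fun x =>
    Submodule.mem_span_singleton.mp (hfdom ▸ x.2)
  have hx₀dom : ∀ t : ℝ, t • x₀ ∈ f.domain := fun t => by
    rw [hfdom]
    exact Submodule.smul_mem _ _ (Submodule.mem_span_singleton_self x₀)
  -- nonnegativity of `f` on `P ∩ ℝ ∙ x₀`
  have hnonneg : ∀ x : f.domain, (x : E) ∈ P → 0 ≤ f x := by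
    intro x hxP
    obtain ⟨t, ht⟩ := hfmem x
    rw [hfapply t x ht.symm]
    rcases lt_or_ge t 0 with htneg | htnonneg
    swap
    · exact htnonneg
    exfalso
    have hneg : InP (-(x : E)) := by
      rw [← ht, ← neg_smul]
      exact hPsmul (-t) x₀ (by linarith) hx₀P
    rcases (hmemP x).mp hxP with hx0 | hxP'
    · rw [← ht] at hx0
      rcases smul_eq_zero.mp hx0 with h | h
      · exact (lt_irrefl (0 : ℝ)) (h ▸ htneg)
      · exact hx₀ne h
    · exact hP0 _ (hPadd _ _ hxP' hneg) (add_neg_cancel (x : E))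
  -- `ℝ ∙ x₀ + P = E` (algebraic openness of `Q` at `q₀`, and `Q` is a cone)
  have hdense : ∀ y : E, ∃ x : f.domain, (x : E) + y ∈ P := by
    intro y
    obtain ⟨δ, hδ, hδQ⟩ := hopen q₀ hq₀ y
    have hmem : q₀ + δ • y ∈ Q := hδQ δ (by rw [abs_of_pos hδ])
    have hmem' : δ⁻¹ • q₀ + y ∈ Q := by
      have := hcone _ _ (inv_pos.mpr hδ) hmem
      rwa [smul_add, smul_smul, inv_mul_cancel₀ hδ.ne', one_smul] at this
    refine ⟨⟨δ⁻¹ • x₀, hx₀dom δ⁻¹⟩, ?_⟩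
    refine (hmemP _).mpr (Or.inr ⟨δ⁻¹ • q₀ + y, hmem', δ⁻¹, inv_pos.mpr hδ, 0, V.zero_mem, ?_⟩)
    simp only [hx₀]
    module
  obtain ⟨g, hgf, hgP⟩ := riesz_extension P f hnonneg hdense
  -- `g x₀ = 1`
  have hgx₀ : g x₀ = 1 := by
    have := hgf ⟨(1 : ℝ) • x₀, hx₀dom 1⟩
    rw [hfapply 1 _ rfl] at this
    simpa using this
  -- `g ≥ 0` on the nonzero part
  have hgInP : ∀ x : E, InP x → 0 ≤ g x := fun x hx => hgP x ((hmemP x).mpr (Or.inr hx))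
  -- `g = 0` on `V`
  have hgV : ∀ v ∈ V, g v = 0 := by
    intro v hv
    by_contra hgv
    have hs : ∀ s : ℝ, 0 ≤ 1 + s * g v := by
      intro s
      have hmem : InP (x₀ + s • v) :=
        ⟨q₀, hq₀, 1, one_pos, s • v, V.smul_mem s hv, by simp [hx₀]⟩
      have := hgInP _ hmem
      rwa [map_add, map_smul, hgx₀, smul_eq_mul] at this
    have := hs (-2 / g v)
    rw [div_mul_cancel₀ _ hgv] at this
    linarith
  -- `g > 0` on `Q`
  have hgQ : ∀ q ∈ Q, 0 < g q := by
    intro q hq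
    obtain ⟨δ, hδ, hδQ⟩ := hopen q hq x₀
    have hmem : q + (-δ) • x₀ ∈ Q := hδQ (-δ) (by rw [abs_neg, abs_of_pos hδ])
    have := hgInP _ (hQP _ hmem)
    rw [map_add, map_smul, hgx₀, smul_eq_mul, mul_one] at this
    linarith
  -- `g a ≤ 0`
  have hga : g a ≤ 0 := by
    refine le_of_not_gt fun hga => ?_
    have hgq₀ : 0 < g q₀ := hgQ q₀ hq₀
    have hc : ∀ c : ℝ, 0 < c → 0 ≤ c * g q₀ - g a := by
      intro c hc
      have hmem : InP (c • q₀ - a) :=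
        ⟨c • q₀, hcone c q₀ hc hq₀, 1, one_pos, 0, V.zero_mem, by simp⟩
      have := hgInP _ hmem
      rwa [map_sub, map_smul, smul_eq_mul] at this
    have := hc (g a / (2 * g q₀)) (by positivity)
    rw [div_mul_eq_mul_div, mul_comm (g a) (g q₀), ← div_mul_eq_mul_div] at this
    have h' : g q₀ / (2 * g q₀) = 1 / 2 := by
      field_simp
    rw [h'] at this
    linarith
  exact ⟨g, hgQ, hgV, hga⟩

end Summit.SmoothPoincare4.SmoothPoincare4.Theorems
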